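import Mathlib
import HarnessLib

/-!
# `DigitPolyUniformity` (stmt-QuantumAdvantage-1392), line `Sketch` — stub `stub_lift_basic`
# (Stub E0: the lift `f` of the chirp `φ`: interface, periodicity, and the prime `2`)

Crux `Summit.QuantumAdvantage.QuantumAdvantage.Theses.MobiusLadder.DigitPolyUniformity` (route
`MobiusLadder`); line `Sketch`, cycle 6 (chirps). The line builds a `±1` function `f` of the `K = V + k`
low binary digits of `N`: `f = 1` on multiples of `2^V`, and `f(2^v r') = (−1)^v φ(r')` for `r'` odd,
`v < V`, where `φ` is a `±1` function of `u mod 2^k`. Here `f` is GIVEN by the explicit formula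
`f(r) = if 2^V ∣ r then 1 else (−1)^{v₂(r)} φ(r / 2^{v₂(r)})` (`v₂ = padicValNat 2`), and this file proves
the interface the other stubs consume:

1. `f = 1` on multiples of `2^V`;
2. the dyadic formula `f(2^v r') = (−1)^v φ(r')` (`v < V`, `r'` odd);
3. `f` has period `2^{V+k}`;
4. `f = ±1`;
5. the `×2`-defect: `f(2r) = −f(r)` unless `2^{V−1} ∣ r`, so `#{r < 2^{V+k} : f(2r) = f(r)} ≤ 2^{k+1}`.

All elementary (`padicValNat` API, `Nat.exists_eq_two_pow_mul_odd`).
-/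

noncomputable section

namespace Summit.QuantumAdvantage.DigitPolyUniformity.SketchLAR.Chirp

open Finset

/-- The `2`-adic valuation of `2^v * r'` with `r'` odd is `v`. [folklore] -/
theorem padicValNat_two_pow_mul_odd (v r' : ℕ) (hr' : Odd r') :
    padicValNat 2 (2 ^ v * r') = v := by
  have h2 : (2 : ℕ) ^ v ≠ 0 := by positivity
  have hr0 : r' ≠ 0 := by rintro rfl; exact Nat.not_odd_zero hr'
  rw [padicValNat.mul h2 hr0, padicValNat.prime_pow,
    padicValNat.eq_zero_of_not_dvd hr'.not_two_dvd_nat, add_zero]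

/-- `2^V ∤ 2^v * r'` for `v < V` and `r'` odd. [folklore] -/
theorem not_two_pow_dvd_two_pow_mul_odd (V v r' : ℕ) (hv : v < V) (hr' : Odd r') :
    ¬ 2 ^ V ∣ 2 ^ v * r' := by
  intro h
  have h1 : 2 ^ (v + 1) ∣ 2 ^ v * r' := (pow_dvd_pow 2 hv).trans h
  rw [pow_succ] at h1
  exact hr'.not_two_dvd_nat (Nat.dvd_of_mul_dvd_mul_left (by positivity) h1)

/-- **Stub E0 (the lift: interface and the prime 2).** With `f(r) = 1` if `2^V ∣ r` and
`f(r) = (−1)^{v₂(r)} φ(r/2^{v₂(r)})` otherwise (`φ` a `±1`-function of `u mod 2^k`): `f(2^v r') = (−1)^v φ(r')` for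
`v < V`, `r'` odd; `f` has period `2^{V+k}`; `f = ±1`; and `f(2r) = −f(r)` unless `2^{V−1} ∣ r`, so
`#{r < 2^{V+k} : f(2r) = f(r)} ≤ 2^{k+1}`. [folklore] -/
theorem stub_lift_basic (k V : ℕ) (φ : ℕ → ℝ) (hφ1 : ∀ u, φ u = 1 ∨ φ u = -1)
    (hφper : ∀ u, φ (u % 2 ^ k) = φ u) (f : ℕ → ℝ)
    (hf : ∀ r, f r = if 2 ^ V ∣ r then 1 else (-1) ^ padicValNat 2 r * φ (r / 2 ^ padicValNat 2 r)) :
    (∀ r, 2 ^ V ∣ r → f r = 1) ∧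
    (∀ v r', v < V → Odd r' → f (2 ^ v * r') = (-1) ^ v * φ r') ∧
    (∀ r, f (r % 2 ^ (V + k)) = f r) ∧
    (∀ r, f r = 1 ∨ f r = -1) ∧
    ((((range (2 ^ (V + k))).filter (fun r => f (2 * r) = f r)).card : ℝ) ≤ 2 ^ (k + 1)) := by
  -- (1) `f = 1` on multiples of `2^V`
  have hf0 : ∀ r, 2 ^ V ∣ r → f r = 1 := fun r hr => by rw [hf r, if_pos hr]
  -- (2) the dyadic formula
  have hfv : ∀ v r', v < V → Odd r' → f (2 ^ v * r') = (-1) ^ v * φ r' := by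
    intro v r' hv hr'
    rw [hf, if_neg (not_two_pow_dvd_two_pow_mul_odd V v r' hv hr'),
      padicValNat_two_pow_mul_odd v r' hr', Nat.mul_div_right r' (by positivity)]
  -- (4) `f = ±1`
  have hf1 : ∀ r, f r = 1 ∨ f r = -1 := by
    intro r
    rw [hf r]
    split_ifs with h
    · exact Or.inl rfl
    · rcases neg_one_pow_eq_or ℝ (padicValNat 2 r) with h1 | h1 <;>
        rcases hφ1 (r / 2 ^ padicValNat 2 r) with h2 | h2 <;>
        norm_num [h1, h2]
  -- dyadic decomposition of a non-multiple of `2^V`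
  have hdec : ∀ r, ¬ 2 ^ V ∣ r → ∃ v r', v < V ∧ Odd r' ∧ r = 2 ^ v * r' := by
    intro r hr
    have hr0 : r ≠ 0 := by rintro rfl; exact hr (dvd_zero _)
    obtain ⟨v, r', hr', rfl⟩ := Nat.exists_eq_two_pow_mul_odd hr0
    refine ⟨v, r', ?_, hr', rfl⟩
    by_contra hvV
    exact hr ((pow_dvd_pow 2 (not_lt.mp hvV)).trans (dvd_mul_right _ _))
  -- (3) period `2^(V+k)`
  have hfper : ∀ r, f (r % 2 ^ (V + k)) = f r := by
    intro r
    by_cases hr : 2 ^ V ∣ r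
    · rw [hf0 r hr, hf0 _ ((Nat.dvd_mod_iff (pow_dvd_pow 2 (Nat.le_add_right V k))).mpr hr)]
    · obtain ⟨v, r', hv, hr', rfl⟩ := hdec r hr
      have hsplit : 2 ^ (V + k) = 2 ^ v * 2 ^ (V + k - v) := by
        rw [← pow_add]; congr 1; omega
      have hodd : Odd (r' % 2 ^ (V + k - v)) :=
        hr'.mod_even ((Nat.even_pow' (by omega)).mpr even_two)
      rw [hsplit, Nat.mul_mod_mul_left, hfv v _ hv hodd, hfv v r' hv hr']
      congr 1
      calc φ (r' % 2 ^ (V + k - v)) = φ (r' % 2 ^ (V + k - v) % 2 ^ k) := (hφper _).symm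
        _ = φ (r' % 2 ^ k) := by
          rw [Nat.mod_mod_of_dvd _ (pow_dvd_pow 2 (by omega : k ≤ V + k - v))]
        _ = φ r' := hφper r'
  refine ⟨hf0, hfv, hfper, hf1, ?_⟩
  -- (5) the `×2`-defect
  rcases Nat.eq_zero_or_pos V with hV | hV
  · -- `V = 0`: bound by the whole range, `2^(0+k) ≤ 2^(k+1)`
    calc (((range (2 ^ (V + k))).filter (fun r => f (2 * r) = f r)).card : ℝ)
        ≤ ((range (2 ^ (V + k))).card : ℝ) := by exact_mod_cast card_filter_le _ _
      _ = 2 ^ (V + k) := by simp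
      _ ≤ 2 ^ (k + 1) := pow_le_pow_right₀ (by norm_num) (by omega)
  · -- `V ≥ 1`: the defect set consists of multiples of `2^(V-1)`
    have hsub : (range (2 ^ (V + k))).filter (fun r => f (2 * r) = f r) ⊆
        (range (2 ^ (k + 1))).image (fun q => 2 ^ (V - 1) * q) := by
      intro r hr
      rw [mem_filter, mem_range] at hr
      obtain ⟨hrlt, hreq⟩ := hr
      have hdvd : 2 ^ (V - 1) ∣ r := by
        by_contra hnd
        obtain ⟨v, r', hv, hr', rfl⟩ :=
          hdec r (fun h => hnd ((pow_dvd_pow 2 (Nat.sub_le V 1)).trans h))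
        have hv1 : v + 1 < V := by
          by_contra hv1
          exact hnd ((pow_dvd_pow 2 (by omega : V - 1 ≤ v)).trans (dvd_mul_right _ _))
        have h2r : 2 * (2 ^ v * r') = 2 ^ (v + 1) * r' := by ring
        rw [h2r, hfv (v + 1) r' hv1 hr', hfv v r' hv hr', pow_succ] at hreq
        rcases hφ1 r' with h | h <;> rcases neg_one_pow_eq_or ℝ v with h' | h' <;>
          norm_num [h, h'] at hreq
      obtain ⟨q, rfl⟩ := hdvd
      rw [mem_image]
      refine ⟨q, mem_range.mpr ?_, rfl⟩
      have hVk : 2 ^ (V + k) = 2 ^ (V - 1) * 2 ^ (k + 1) := by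
        rw [← pow_add]; congr 1; omega
      rw [hVk] at hrlt
      exact Nat.lt_of_mul_lt_mul_left hrlt
    calc (((range (2 ^ (V + k))).filter (fun r => f (2 * r) = f r)).card : ℝ)
        ≤ (((range (2 ^ (k + 1))).image (fun q => 2 ^ (V - 1) * q)).card : ℝ) := by
          exact_mod_cast card_le_card hsub
      _ ≤ ((range (2 ^ (k + 1))).card : ℝ) := by exact_mod_cast card_image_le
      _ = 2 ^ (k + 1) := by simp

end Summit.QuantumAdvantage.DigitPolyUniformity.SketchLAR.Chirp

end
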